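import Mathlib.Tactic.Linarith
import Summits.ABC.IUTFork.ForkCopies
import Summits.ABC.IUTFork.Cor312RemarksToy
import HarnessLib

/-!
# [IUTchIII] Remark 3.12.2 (ii): the toy model (a^toy)–(f^toy) and Mochizuki's (Smm) are one template (c312 crew, wave 2, V)

Bridge file (bookkeeping only) between two typings of the author's own real-number caricature of the
disputed step: the toy model (a^toy)–(f^toy) of [IUTchIII] Remark 3.12.2 (ii) (kurims pp. 190–191;
`Cor312RemarksToy.lean`: `Toy`, `λ_q : ∗ ↦ q(−h)`, `λ_Θ : ∗ ↦ Θ(−2h)`, `λ^{Ind}_Θ : ∗ ↦ ℝ_{≤−2h+ε}`, `SpecialCase`,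
`ftoy_bound : h ≤ ε`) and the two-number summary (Smm) of Mochizuki's *Report* (2018) §1 p. 2 typed by
abc-iut-skel in `ForkCopies.lean` §3 (`Smm`: "`−2B = −A`" = `ThetaLink`, "`−2B ≤ −2A + 1`" = `Multiradial`,
"`A ≤ 1`" = `Smm.bound`, "`A = B`" = `Identified`, `identified_absurd`). Dictionary: `h := A`, `ε := 1`; then,
GIVEN the Θ-link relation `−2B = −A`, (Smm)'s "theorem `−2B ≤ −2A + 1`" is literally the toy's (e^toy)/(f^toy)
supposition "`−h ∈ ℝ_{≤−2h+ε}`" (`multiradial_iff_specialCase`), (Smm)'s bound `A ≤ 1` is the toy's `h ≤ ε`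
(`specialCase_iff_bound`), and (Smm)'s "`A = B` ⟹ `A = B = 0`, absurd" is the toy's (a^toy) "`−h ≠ −2h`"
(`forget_eq_of_identified`, `identified_absurd_via_toy`). All PROVED (linear arithmetic); nothing here takes
a side on Cor. 3.12 — both objects are the AUTHOR's illustrations, typed record-only (claim keys
`Mochizuki2012`, `Mochizuki2019Report`).
-/

namespace Summit.ABC.IUTFork.Cor312Rmk

namespace Toy

/-- The toy model of Rmk 3.12.2 (ii) attached to (Smm) data `A, B > 0` (Report 2018 §1 p. 2): `h := A` ("that
we are interested in bounding from above"), `ε := 1` (the "+1" of "`−2B ≤ −2A + 1`").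
[cite: Mochizuki2012, III Rmk 3.12.2 (ii) p.190] -/
def ofSmm (S : Smm) : Toy := ⟨S.A, 1, S.A_pos, one_pos⟩

/-- `h = A`. [cite: Mochizuki2012, III Rmk 3.12.2 (ii) p.190] -/
theorem ofSmm_h (S : Smm) : (ofSmm S).h = S.A := rfl

/-- `ε = 1`. [cite: Mochizuki2012, III Rmk 3.12.2 (ii) p.190] -/
theorem ofSmm_ε (S : Smm) : (ofSmm S).ε = 1 := rfl

/-- (Smm)'s bound "`A ≤ 1` (which corresponds to [IUTchIII], Corollary 3.12)" IS the toy's (e^toy)/(f^toy)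
supposition `SpecialCase` ("«`∗ ↦ −h`» may be regarded as a special case of «`∗ ↦ ℝ_{≤−2h+ε}`»") for `h = A`,
`ε = 1`. PROVED (`Toy.specialCase_iff`). [cite: Mochizuki2019Report, §1 p. 2 (Smm)] -/
theorem specialCase_iff_bound (S : Smm) : (ofSmm S).SpecialCase ↔ S.A ≤ 1 :=
  (ofSmm S).specialCase_iff

/-- Given the Θ-link relation "`−2B = −A`", (Smm)'s "theorem `−2B ≤ −2A + 1` (which corresponds to the
multiradial representation of [IUTchIII], Theorem 3.11)" is EQUIVALENT to the toy's supposition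
`−h ∈ ℝ_{≤−2h+ε}` (`h = A`, `ε = 1`). PROVED. [cite: Mochizuki2019Report, §1 p. 2 (Smm)] -/
theorem multiradial_iff_specialCase (S : Smm) (hlink : S.ThetaLink) :
    S.Multiradial ↔ (ofSmm S).SpecialCase := by
  rw [specialCase_iff_bound]
  unfold Smm.ThetaLink at hlink
  unfold Smm.Multiradial
  constructor <;> intro h <;> linarith

/-- (Smm)'s first deduction through the toy: `ThetaLink ∧ Multiradial ⟹ SpecialCase ⟹ h ≤ ε`, i.e. `A ≤ 1`
— the same conclusion as skel's `Smm.bound`, reached via `Toy.ftoy_bound`. PROVED.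
[cite: Mochizuki2019Report, §1 p. 2 (Smm)] -/
theorem smm_bound_via_toy (S : Smm) (hlink : S.ThetaLink) (hmul : S.Multiradial) : S.A ≤ 1 := by
  have h := (ofSmm S).ftoy_bound ((multiradial_iff_specialCase S hlink).mp hmul)
  simpa [ofSmm_h, ofSmm_ε] using h

/-- (Smm)'s "`A = B`" together with the Θ-link relation forces the two toy assignments to have the SAME
underlying real number (`−h = −2h`), which is exactly what (a^toy) says cannot happen
(`Toy.atoy_forget_ne`). PROVED. [cite: Mochizuki2019Report, §1 p. 2 (Smm)] -/
theorem forget_eq_of_identified (S : Smm) (hid : S.Identified) (hlink : S.ThetaLink) :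
    forget (ofSmm S).lamQ = forget (ofSmm S).lamTheta := by
  unfold Smm.Identified at hid; unfold Smm.ThetaLink at hlink
  show -S.A = -2 * S.A
  rw [← hid] at hlink; linarith

/-- (Smm)'s second deduction ("`A = B` … implies … `A = B = 0`, in contradiction to the initial assumption")
through the toy's (a^toy) ("`ℝ ∋ −h ≠ −2h ∈ ℝ`"): same `False` as skel's `Smm.identified_absurd`. PROVED.
[cite: Mochizuki2019Report, §1 p. 2 (Smm)] -/
theorem identified_absurd_via_toy (S : Smm) (hid : S.Identified) (hlink : S.ThetaLink) : False :=
  (ofSmm S).atoy_forget_ne (forget_eq_of_identified S hid hlink)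

end Toy

end Summit.ABC.IUTFork.Cor312Rmk
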